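import Mathlib.Analysis.SpecialFunctions.Trigonometric.Chebyshev.RootsExtrema
import Mathlib.Algebra.Polynomial.Derivative
import Mathlib.Analysis.SpecialFunctions.Exp

/-!
# YM-DAG node N19 (= NE7 proper) — THE PRICE OF THE EXPECTATION CURRENCY IS INTRINSICALLY SUPER-LINEAR, I: the transported
# Chebyshev polynomial `T_M ∘ ((X − 1)∕r)` — `ℓ¹`-size of its coefficient vector, mass zero, first moment `±M∕r` (analytic core)

Cell `pub-ymgap`, HUMAN RULING D-0062 (Track A), R141 (C) wider-strategy seat `pub-ymgap-dag-n19-e` (strategy s3 = ALTERNATIVE CURRENCY),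
generation g10.  Route `Summits/QuantumFields/YangMills/Theses/BalabanUVNodes.lean` rev 19, cluster item K3⁗ «SpineGivenEndpointR13Sep»
(stmt-QuantumFields-20292); filed `--supports` that item `--as helper` (it proves no registered stub).  COUNT-NEUTRAL: elementary real analysis
over Mathlib's Chebyshev polynomials (`Polynomial.Chebyshev.T ∕ U`, `abs_eval_T_real_le_one`, `T_eval_zero_of_odd`, `U_eval_zero_of_even`,
`T_derivative_eq_U`, `leadingCoeff_T`, `natDegree_T`, all BY NAME); no scheme object, no measure, no Theses import; NOT a discharge claim.

WHAT THIS FILE IS FOR.  The seat's expectation-currency ladder (g4 `…N19ExpectationCurrency` p477102 ∕ p477267: Landau, price `√ε`; g5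
`…N19ExpectationCurrencyTwoConstants` p480837 ∕ `…AtScheme` p481156 ∕ `…Rate` p482030: two constants, price `ε·(1 + log⁺ ε⁻¹)`) converts N19's
DECL-target currency — two laws whose cumulant ∕ moment generating functions are `ε`-close on a real WINDOW `|t| ≤ l₀` — into closeness of MEANS,
at the LINEAR-LOG price `|E_ν − E_μ| ≤ 4e^{1+l₀B}·ε·(1 + log⁺ ε⁻¹)∕l₀` (p480837 `abs_integral_sub_integral_le_linlog_of_cgf_close`).  The g5 header
and the desk's HANDOFF (v5 (b′)) left OPEN whether the logarithm is an artefact of the two-constants proof or intrinsic («a LINEAR price is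
impossible — prose, NOT typed; whether log⁺ or a smaller loss (√log …) is sharp is OPEN»).  This file (the polynomial bookkeeping) and
its siblings `…Theorems.BalabanUVNodesN19NoLinearPrice` (exponential sums, the two laws, no linear price) and `…NoLinearPriceSharp` (the exponent
of the logarithm), filed right after under the 400-line rule, SETTLE the first question and most of the second, CONSTRUCTIVELY:

* for every window `0 < l₀` and odd `M`: two probability laws on `[0, 1]` with mgf's `ε`-close on `|t| ≤ l₀`, `ε ≤ 4·(l₀e^{l₀}∕(2M))^M`,
  and means EXACTLY `ε∕(e^{l₀∕M} − 1) ≥ (M·e^{−l₀}∕l₀)·ε` apart — NO LINEAR PRICE `|ΔE| ≤ C(l₀)·ε` exists;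
* along the family `log ε⁻¹ ≤ M·log(1 + 4M∕l₀)`, so `|ΔE|∕ε ≳ log ε⁻¹ ∕ log log ε⁻¹`: the exponent `1` of the logarithm cannot be lowered to any
  `a < 1` (sibling `linlog_exponent_one_sharp`); «√log» is REFUTED; open remains only the `log log` between this family and p480837's bound.

THE WITNESS (assembled in the sibling, §4 there; no measure theory until §5 there).  With `r := e^{l₀∕M} − 1` and `P_M := T_M ∘ ((X − 1)∕r)` (the
Chebyshev polynomial of the first kind transported to `[1 − r, 1 + r]`), put `w_j := (2∕Λ)·[uʲ]P_M` (`Λ = ∑_j |[uʲ]P_M|`).  Then the exponential sum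
on the grid `{j∕M} ⊂ [0,1]` `f(t) := ∑_j w_j e^{t·j∕M} = (2∕Λ)·P_M(e^{t∕M}) = (2∕Λ)·T_M(s(t))`, `s(t) = (e^{t∕M} − 1)∕r ∈ [−1, 1]` for `|t| ≤ l₀`, is
bounded by `ε := 2∕Λ` on the window and equals `ε` at `t = l₀` (`T_M(1) = 1`); `∑ w_j = (2∕Λ)·T_M(0) = 0` (odd `M`); `∑|w_j| = 2`; and the first
moment is `∑_j w_j·(j∕M) = (2∕Λ)·P_M′(1)∕M = (2∕Λ)·T_M′(0)∕(M·r) = ±ε∕r` (`T_M′ = M·U_{M−1}`, `U_{M−1}(0) = ±1`) — Chebyshev's extremal growth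
`T_M′(0) = ±M` of the derivative at the centre, against `sup_{[−1,1]}|T_M| = 1`.  THIS FILE supplies the polynomial facts: §1 `ℓ¹`-sums of
coefficient vectors over a fixed range (never named); §2 `natDegree ∕ leadingCoeff ∕ eval` of `P_n`, the transported recurrence
`P_{n+2} = (2∕r)(X − 1)P_{n+1} − P_n`, ★ `sum_abs_coeff_chebAff_le` (`Λ_n ≤ (1 + 4∕r)^n`, from `‖X·P‖₁ = ‖P‖₁` and `(4∕r)(1 + 4∕r) + 1 ≤ (1 + 4∕r)²`),
`pow_le_sum_abs_coeff_chebAff` (`Λ_M ≥ 2^{M−1}r^{−M}`), `sum_coeff_chebAff_eq_zero` (odd `M`), ★ `abs_sum_coeff_mul_chebAff` (`|∑_j j·[uʲ]P_M| = M∕r`),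
`abs_eval_chebAff_le_one`, `eval_chebAff_one_add` (0 `def`, 0 `sorry`; every statement displays Mathlib's objects).

HONEST FRAMING (binding).  Elementary and [folklore] in content (Chebyshev ∕ Markov–Bernstein extremality; the transport to exponential sums on a
grid and the bookkeeping are this file's); NO consumer in the DAG today — the apex `T4ApexHybrid.HybridNE7Under ⇒ StringwiseGenFunCauchy ⇒
HasContinuumLimit` consumes EXISTENCE of limits, not rates; the value is an OPTIMALITY certificate for the lineage's rate theorems and a typed
statement that «matching mod constants on a window» is a STRICTLY WEAKER currency than «matching of expectations at the same rate».  Nothing of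
Bałaban's is instantiated; NE7 ∕ NE7b ∕ NE7c are NOT PRINTED and NOT proved; N19 is NOT discharged; count-neutral.  One finite `T⁴` programme at
fixed `ε`; nothing continuum ∕ `ℝ⁴` ∕ OS ∕ mass-gap ∕ Clay.
-/

noncomputable section

open Polynomial Real Finset

namespace Summit.QuantumFields.YangMills.Theorems.BalabanUVNodesN19NoLinearPriceWitness

/-! ## §1 Coefficient `ℓ¹`-sums over a fixed range

For a real polynomial `p` and a range `D` exceeding its degree, `∑_{j<D} |p.coeff j|` is the `ℓ¹`-norm of its coefficient
vector; we never name it, and only use the four bookkeeping facts below. -/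

/-- `ℓ¹` of a sum. [folklore] -/
theorem sum_abs_coeff_add_le (p q : ℝ[X]) (D : ℕ) :
    ∑ j ∈ range D, |(p + q).coeff j| ≤ ∑ j ∈ range D, |p.coeff j| + ∑ j ∈ range D, |q.coeff j| := by
  rw [← sum_add_distrib]
  exact sum_le_sum fun j _ => by rw [coeff_add]; exact abs_add_le _ _

/-- `ℓ¹` of a difference. [folklore] -/
theorem sum_abs_coeff_sub_le (p q : ℝ[X]) (D : ℕ) :
    ∑ j ∈ range D, |(p - q).coeff j| ≤ ∑ j ∈ range D, |p.coeff j| + ∑ j ∈ range D, |q.coeff j| := by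
  rw [← sum_add_distrib]
  exact sum_le_sum fun j _ => by rw [coeff_sub]; exact abs_sub _ _

/-- `ℓ¹` of a scalar multiple. [folklore] -/
theorem sum_abs_coeff_C_mul (a : ℝ) (p : ℝ[X]) (D : ℕ) :
    ∑ j ∈ range D, |(C a * p).coeff j| = |a| * ∑ j ∈ range D, |p.coeff j| := by
  rw [mul_sum]
  exact sum_congr rfl fun j _ => by rw [coeff_C_mul, abs_mul]

/-- Multiplication by `X` shifts the coefficient vector: the `ℓ¹`-sum over `range (D+1)` is unchanged as long as
nothing is shifted out (`p.coeff D = 0`). [folklore] -/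
theorem sum_abs_coeff_X_mul (p : ℝ[X]) {D : ℕ} (hp : p.coeff D = 0) :
    ∑ j ∈ range (D + 1), |(X * p).coeff j| = ∑ j ∈ range (D + 1), |p.coeff j| := by
  rw [sum_range_succ', coeff_X_mul_zero, abs_zero, add_zero, sum_range_succ, hp, abs_zero, add_zero]
  exact sum_congr rfl fun j _ => by rw [coeff_X_mul]

/-- On `|u| ≤ 1` a polynomial is bounded by the `ℓ¹`-sum of its coefficients. [folklore] -/
theorem abs_eval_le_sum_abs_coeff (p : ℝ[X]) {D : ℕ} (hp : p.natDegree < D) {u : ℝ} (hu : |u| ≤ 1) :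
    |p.eval u| ≤ ∑ j ∈ range D, |p.coeff j| := by
  rw [eval_eq_sum_range' hp]
  refine (abs_sum_le_sum_abs _ _).trans (sum_le_sum fun j _ => ?_)
  rw [abs_mul, abs_pow]
  exact mul_le_of_le_one_right (abs_nonneg _) (pow_le_one₀ (abs_nonneg _) hu)

/-- A single coefficient is bounded by the `ℓ¹`-sum. [folklore] -/
theorem abs_coeff_le_sum_abs_coeff (p : ℝ[X]) {D j : ℕ} (hj : j < D) :
    |p.coeff j| ≤ ∑ i ∈ range D, |p.coeff i| :=
  single_le_sum (f := fun i => |p.coeff i|) (fun _ _ => abs_nonneg _) (mem_range.mpr hj)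

/-- The sum of the coefficients is the value at `1`. [folklore] -/
theorem sum_coeff_eq_eval_one (p : ℝ[X]) {D : ℕ} (hp : p.natDegree < D) :
    ∑ j ∈ range D, p.coeff j = p.eval 1 := by
  rw [eval_eq_sum_range' hp]
  exact sum_congr rfl fun j _ => by rw [one_pow, mul_one]

/-- The first moment of the coefficient vector is the derivative at `1`. [folklore] -/
theorem sum_coeff_mul_eq_derivative_eval_one (p : ℝ[X]) {D : ℕ} (hp : p.natDegree < D) :
    ∑ j ∈ range D, p.coeff j * j = p.derivative.eval 1 := by
  rw [derivative_eval, sum_over_range' _ _ _ hp]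
  · exact sum_congr rfl fun j _ => by rw [one_pow, mul_one]
  · intro j
    rw [zero_mul, zero_mul]

/-! ## §2 The Chebyshev polynomial composed with the affine map `u ↦ (u − 1)∕r`

`P_n := T_n ∘ q`, `q = r⁻¹·(X − 1)`: the `n`-th Chebyshev polynomial of the first kind transported to the interval
`[1 − r, 1 + r]`.  We never name `P_n` either; every statement displays `(T ℝ n).comp (C r⁻¹ * (X - C 1))`. -/

/-- The affine map has degree `1`. [folklore] -/
theorem natDegree_affine {r : ℝ} (hr : r ≠ 0) : (C r⁻¹ * (X - C 1) : ℝ[X]).natDegree = 1 := by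
  rw [natDegree_C_mul (inv_ne_zero hr), natDegree_X_sub_C]

/-- … and leading coefficient `r⁻¹`. [folklore] -/
theorem leadingCoeff_affine (r : ℝ) : (C r⁻¹ * (X - C 1) : ℝ[X]).leadingCoeff = r⁻¹ := by
  rw [leadingCoeff_mul, leadingCoeff_C, leadingCoeff_X_sub_C, mul_one]

/-- `P_n` has degree `n`. [folklore] -/
theorem natDegree_chebAff {r : ℝ} (hr : r ≠ 0) (n : ℕ) :
    ((Chebyshev.T ℝ n).comp (C r⁻¹ * (X - C 1))).natDegree = n := by
  rw [natDegree_comp, natDegree_affine hr, mul_one, Chebyshev.natDegree_T]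
  simp

/-- `P_n` has leading coefficient `2^{n−1}·r^{−n}`. [folklore] -/
theorem leadingCoeff_chebAff {r : ℝ} (hr : r ≠ 0) (n : ℕ) :
    ((Chebyshev.T ℝ n).comp (C r⁻¹ * (X - C 1))).leadingCoeff = 2 ^ (n - 1) * r⁻¹ ^ n := by
  rw [leadingCoeff_comp (by rw [natDegree_affine hr]; exact one_ne_zero), leadingCoeff_affine,
    Chebyshev.leadingCoeff_T, Chebyshev.natDegree_T]
  simp

/-- Evaluation: `P_n(u) = T_n((u − 1)∕r)`. [folklore] -/
theorem eval_chebAff (r : ℝ) (n : ℤ) (u : ℝ) :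
    ((Chebyshev.T ℝ n).comp (C r⁻¹ * (X - C 1))).eval u = (Chebyshev.T ℝ n).eval (r⁻¹ * (u - 1)) := by
  simp only [eval_comp, eval_mul, eval_C, eval_sub, eval_X]

/-- The three-term recurrence transported: `P_{n+2} = 2·q·P_{n+1} − P_n`. [folklore] -/
theorem chebAff_add_two (r : ℝ) (n : ℤ) :
    (Chebyshev.T ℝ (n + 2)).comp (C r⁻¹ * (X - C 1)) =
      2 * (C r⁻¹ * (X - C 1)) * (Chebyshev.T ℝ (n + 1)).comp (C r⁻¹ * (X - C 1)) -
        (Chebyshev.T ℝ n).comp (C r⁻¹ * (X - C 1)) := by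
  rw [Chebyshev.T_add_two]
  simp only [sub_comp, mul_comp, X_comp, ofNat_comp, Nat.cast_ofNat]

/-- `ℓ¹` of the constant polynomial `1` is `1`. [folklore] -/
theorem sum_abs_coeff_one (D : ℕ) : ∑ j ∈ range (D + 1), |(1 : ℝ[X]).coeff j| = 1 := by
  rw [sum_range_succ']
  simp [coeff_one]

/-- `ℓ¹` of `X` is `1` (range at least `2`). [folklore] -/
theorem sum_abs_coeff_X {D : ℕ} (hD : 1 ≤ D) : ∑ j ∈ range (D + 1), |(X : ℝ[X]).coeff j| = 1 := by
  obtain ⟨D, rfl⟩ := Nat.exists_eq_add_of_le' hD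
  rw [sum_range_succ', sum_range_succ']
  simp [coeff_X_of_ne_one]

/-- `ℓ¹` of the affine map is at most `2∕r` (range at least `2`). [folklore] -/
theorem sum_abs_coeff_affine_le {r : ℝ} (hr : 0 < r) {D : ℕ} (hD : 1 ≤ D) :
    ∑ j ∈ range (D + 1), |(C r⁻¹ * (X - C 1) : ℝ[X]).coeff j| ≤ 2 / r := by
  rw [sum_abs_coeff_C_mul, abs_of_pos (inv_pos.mpr hr), div_eq_inv_mul]
  refine mul_le_mul_of_nonneg_left ?_ (inv_pos.mpr hr).le
  refine (sum_abs_coeff_sub_le _ _ _).trans ?_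
  rw [sum_abs_coeff_X hD, C_1, sum_abs_coeff_one]
  norm_num

/-- **THE `ℓ¹` BOUND ALONG THE RECURRENCE**: `∑_{j≤M} |[uʲ] P_n| ≤ (1 + 4∕r)^n` for `n ≤ M` — from
`P_{n+2} = r⁻¹·(2(X·P_{n+1} − P_{n+1})) − P_n`, `‖X·P‖₁ = ‖P‖₁`, and `(4∕r)(1 + 4∕r) + 1 ≤ (1 + 4∕r)²`. [folklore] -/
theorem sum_abs_coeff_chebAff_le {r : ℝ} (hr : 0 < r) (M : ℕ) :
    ∀ n : ℕ, n ≤ M →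
      ∑ j ∈ range (M + 1), |((Chebyshev.T ℝ n).comp (C r⁻¹ * (X - C 1))).coeff j| ≤ (1 + 4 / r) ^ n := by
  intro n
  induction n using Nat.twoStepInduction with
  | zero =>
    intro _
    rw [Nat.cast_zero, Chebyshev.T_zero, one_comp, sum_abs_coeff_one, pow_zero]
  | one =>
    intro h1
    rw [Nat.cast_one, Chebyshev.T_one, X_comp, pow_one]
    refine (sum_abs_coeff_affine_le hr h1).trans ?_
    rw [div_le_iff₀ hr, add_mul, div_mul_cancel₀ _ hr.ne']
    linarith
  | more n ih0 ih1 =>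
    intro hn
    have h0 := ih0 (by omega)
    have h1 := ih1 (by omega)
    have e : (Chebyshev.T ℝ ((n + 2 : ℕ) : ℤ)).comp (C r⁻¹ * (X - C 1)) =
        C r⁻¹ * ((X * (Chebyshev.T ℝ ((n + 1 : ℕ) : ℤ)).comp (C r⁻¹ * (X - C 1)) -
            (Chebyshev.T ℝ ((n + 1 : ℕ) : ℤ)).comp (C r⁻¹ * (X - C 1))) +
          (X * (Chebyshev.T ℝ ((n + 1 : ℕ) : ℤ)).comp (C r⁻¹ * (X - C 1)) -
            (Chebyshev.T ℝ ((n + 1 : ℕ) : ℤ)).comp (C r⁻¹ * (X - C 1)))) -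
          (Chebyshev.T ℝ n).comp (C r⁻¹ * (X - C 1)) := by
      have h := chebAff_add_two r n
      push_cast at h ⊢
      rw [h, C_1]
      ring
    have hdeg : ((Chebyshev.T ℝ ((n + 1 : ℕ) : ℤ)).comp (C r⁻¹ * (X - C 1))).coeff M = 0 :=
      coeff_eq_zero_of_natDegree_lt (by rw [natDegree_chebAff hr.ne']; omega)
    rw [e]
    refine (sum_abs_coeff_sub_le _ _ _).trans ?_
    rw [sum_abs_coeff_C_mul, abs_of_pos (inv_pos.mpr hr)]
    have hR := (sum_abs_coeff_add_le
      (X * (Chebyshev.T ℝ ((n + 1 : ℕ) : ℤ)).comp (C r⁻¹ * (X - C 1)) -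
        (Chebyshev.T ℝ ((n + 1 : ℕ) : ℤ)).comp (C r⁻¹ * (X - C 1)))
      (X * (Chebyshev.T ℝ ((n + 1 : ℕ) : ℤ)).comp (C r⁻¹ * (X - C 1)) -
        (Chebyshev.T ℝ ((n + 1 : ℕ) : ℤ)).comp (C r⁻¹ * (X - C 1))) (M + 1)).trans
      (add_le_add
        ((sum_abs_coeff_sub_le _ _ _).trans (by rw [sum_abs_coeff_X_mul _ hdeg]))
        ((sum_abs_coeff_sub_le _ _ _).trans (by rw [sum_abs_coeff_X_mul _ hdeg])))
    -- `hR : ‖2(X·P − P)‖₁ ≤ (‖P‖₁ + ‖P‖₁) + (‖P‖₁ + ‖P‖₁)`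
    have hb : 0 ≤ (1 + 4 / r) ^ n := by positivity
    calc r⁻¹ * _ + _ ≤ r⁻¹ * (((1 + 4 / r) ^ (n + 1) + (1 + 4 / r) ^ (n + 1)) +
          ((1 + 4 / r) ^ (n + 1) + (1 + 4 / r) ^ (n + 1))) + (1 + 4 / r) ^ n := by
          gcongr
          exact hR.trans (by gcongr)
      _ = (1 + 4 / r) ^ n * ((4 / r) * (1 + 4 / r) + 1) := by rw [div_eq_mul_inv]; ring
      _ ≤ (1 + 4 / r) ^ n * ((1 + 4 / r) * (1 + 4 / r)) :=
          mul_le_mul_of_nonneg_left (by nlinarith [div_pos (four_pos : (0:ℝ) < 4) hr]) hb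
      _ = (1 + 4 / r) ^ (n + 2) := by ring

/-- … and the `ℓ¹`-sum of `P_M` is at least its leading coefficient `2^{M−1}∕r^M`. [folklore] -/
theorem pow_le_sum_abs_coeff_chebAff {r : ℝ} (hr : 0 < r) (M : ℕ) :
    2 ^ (M - 1) * r⁻¹ ^ M ≤ ∑ j ∈ range (M + 1), |((Chebyshev.T ℝ M).comp (C r⁻¹ * (X - C 1))).coeff j| := by
  have h := abs_coeff_le_sum_abs_coeff ((Chebyshev.T ℝ M).comp (C r⁻¹ * (X - C 1))) (Nat.lt_succ_self M)
  have hc : ((Chebyshev.T ℝ M).comp (C r⁻¹ * (X - C 1))).coeff M = 2 ^ (M - 1) * r⁻¹ ^ M := by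
    rw [← leadingCoeff_chebAff hr.ne' M, leadingCoeff, natDegree_chebAff hr.ne' M]
  rwa [hc, abs_of_nonneg (by positivity)] at h

/-- `P_M` has mass zero for odd `M`: `∑_j [uʲ]P_M = P_M(1) = T_M(0) = 0`. [folklore] -/
theorem sum_coeff_chebAff_eq_zero {r : ℝ} (hr : r ≠ 0) {M : ℕ} (hM : Odd M) :
    ∑ j ∈ range (M + 1), ((Chebyshev.T ℝ M).comp (C r⁻¹ * (X - C 1))).coeff j = 0 := by
  rw [sum_coeff_eq_eval_one _ (by rw [natDegree_chebAff hr]; exact Nat.lt_succ_self M), eval_chebAff,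
    sub_self, mul_zero, Chebyshev.T_eval_zero_of_odd ℝ (by exact_mod_cast hM)]

/-- For odd `M`, `|U_{M−1}(0)| = 1`. [folklore] -/
theorem abs_eval_U_zero_eq_one {M : ℕ} (hM : Odd M) : |(Chebyshev.U ℝ ((M : ℤ) - 1)).eval 0| = 1 := by
  have he : Even ((M : ℤ) - 1) := by
    obtain ⟨k, hk⟩ := hM
    exact ⟨k, by omega⟩
  rw [Chebyshev.U_eval_zero_of_even ℝ he]
  rcases Int.units_eq_one_or (((M : ℤ) - 1) / 2).negOnePow with h | h <;> simp [h]

/-- THE FIRST MOMENT of `P_M`'s coefficient vector for odd `M`: `|∑_j j·[uʲ]P_M| = |P_M′(1)| = |T_M′(0)|∕r = M∕r`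
(`T_M′ = M·U_{M−1}`, `U_{M−1}(0) = ±1`). [folklore] -/
theorem abs_sum_coeff_mul_chebAff {r : ℝ} (hr : 0 < r) {M : ℕ} (hM : Odd M) :
    |∑ j ∈ range (M + 1), ((Chebyshev.T ℝ M).comp (C r⁻¹ * (X - C 1))).coeff j * j| = M / r := by
  rw [sum_coeff_mul_eq_derivative_eval_one _ (by rw [natDegree_chebAff hr.ne']; exact Nat.lt_succ_self M),
    derivative_comp]
  have hdq : derivative (C r⁻¹ * (X - C 1) : ℝ[X]) = C r⁻¹ := by
    rw [derivative_C_mul, derivative_sub, derivative_X, derivative_C, sub_zero, mul_one]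
  rw [hdq, eval_mul, eval_C, eval_comp, Chebyshev.T_derivative_eq_U]
  simp only [eval_mul, eval_C, eval_sub, eval_X, sub_self, mul_zero, eval_natCast, Int.cast_natCast]
  rw [abs_mul, abs_mul, abs_eval_U_zero_eq_one hM, mul_one, abs_of_pos (inv_pos.mpr hr),
    abs_of_nonneg (Nat.cast_nonneg M), inv_mul_eq_div]

/-- `|P_n(u)| ≤ 1` whenever `|(u−1)∕r| ≤ 1`. [folklore] -/
theorem abs_eval_chebAff_le_one (r : ℝ) (n : ℤ) {u : ℝ} (hu : |r⁻¹ * (u - 1)| ≤ 1) :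
    |((Chebyshev.T ℝ n).comp (C r⁻¹ * (X - C 1))).eval u| ≤ 1 := by
  rw [eval_chebAff]
  exact Chebyshev.abs_eval_T_real_le_one n hu

/-- `P_n(1 + r) = T_n(1) = 1`. [folklore] -/
theorem eval_chebAff_one_add {r : ℝ} (hr : r ≠ 0) (n : ℤ) :
    ((Chebyshev.T ℝ n).comp (C r⁻¹ * (X - C 1))).eval (1 + r) = 1 := by
  rw [eval_chebAff, add_sub_cancel_left, inv_mul_cancel₀ hr, Chebyshev.T_eval_one]

end Summit.QuantumFields.YangMills.Theorems.BalabanUVNodesN19NoLinearPriceWitness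

end
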